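import Summits.RiemannHypothesis.RiemannHypothesis.Theorems.TiltedLandingLaw421R3LandingDoor

/-!
# lens-1 (rh33346) — ONE-BODY U: the pinned upper cluster door with `S = {v}` from an ISOLATION certificate (v3: POINTWISE form (CA455) + FREE CENTRE (CA462)(2) + FREE MODEL CONSTANT K (CA470)(ii))

(CA449)(3) P-TARGET E; landing image (3e) (helper module, ns `RhW08.Lens1OneBody`).  Nothing here bears on the truth of RH; RH is not
proved; 33346/33347 OPEN.

`clusterNumbersU_of_isolated`: at a SIMPLE upper zero `v` of `F := f^{(j)}` take the disc `D(v, ρ)` CENTRED AT `v` with `0 < ρ ≤ Im v`,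
`|Re v − x₀| + ρ ≤ R/2` (column), ISOLATION `ρ < ‖z − v‖` for every other zero `z` of `F`, NEWTON STRENGTH `1 < ‖K‖·ρ`
(`K = newtonK f j v = (h′/h)(v)`, `h := dslope F v`; places the Newton child `v − K⁻¹` inside the disc), and the POINTWISE Rouché clause
`ρ·‖(h′/h)(z) − K‖ < ‖1 + K·(z − v)‖` on the circle `‖z − v‖ = ρ` (v0 had the UNIFORM right-hand side `‖K‖ρ − 1`, which costs up to two
units of margin on cell E — crit-1 HANDS-8b; kept as the corollary `clusterNumbersU_of_isolated_of_uniform` via `norm_model_ge`).  Then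
`RhW08.AntiEscapeSplit7.ClusterNumbersU f x₀ R j` (the Q8 door U of record) holds with the one-body witness `S = {v}`, `m ≡ 1`, centre `v`,
model `M = 1 + K·(z − v)`.  Frame corollary `succ_of_isolated` := `succ_of_clusterNumbersU`.

§2 (v3, (CA462)(2) + (CA470)(ii)) FREE CENTRE AND FREE MODEL CONSTANT: the disc `D(c, ρ)` need not be centred at `v`, and the model
constant `K : ℂ` is a WITNESS (any `K` with its model zero `v − K⁻¹` in the disc; `newtonK f j v = (h′/h)(v)` stays the documented
prediction — census K-C6b: free `(c, ρ, K)` certifies 52/52 column-feasible E rows of TABLE S, `K = newtonK` only 40/56) —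
`oneBody_model_data` (cofactor entire, zero-free on `D̄(c, ρ)`, model domination on `‖z − c‖ = ρ` from the pointwise clause
`‖z − v‖·‖(h′/h)(z) − K‖ < ‖1 + K(z − v)‖`),
`clusterNumbersU_of_isolated_center` (door U: `ρ ≤ Im c`, column `|Re c − x₀| + ρ ≤ R/2`, model zero `v − K⁻¹ ∈ D(c, ρ)`), and the
successor-currency form `succ_of_isolated_pt` with the column clause replaced by the POINTWISE level-`(j+1)` window on the disc
(`RhW08.ClusterQM.succ_of_upper_model_zero_pt`; lateral overhang of the column edge allowed) — the owner candidate for the E rows at a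
column edge (census K-C6: 20/56, column room `< 1/‖K‖`).
-/

set_option linter.unusedVariables false
set_option linter.unusedSectionVars false

namespace RhW08.Lens1OneBody

noncomputable section

open Complex Set Filter Metric Topology
open scoped ComplexConjugate
open Literature.Analysis.Complex
open RhIdea6.G17.W07C7 RhIdea6.G17.W07C7.Rev6 RhIdea6.G18.W07C8.Law421BirthS RhIdea6.G19.W07C11.Seam
open RhIdea6.G20.W07C12.Frac RhIdea6.G20.W07C12.StColP RhW07.C12.FieldSplit RhIdea6.G21.W07C13.TentMax
open RhW07.C14.TwoSided RhW07.C14.Classes RhW07.C14.Lineage RhW07.C14.Booking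
open RhW07.C13.Heredity RhIdea6.G22.W07C15pre.Injection RhW07.E3.Cell RhW07.E3.Lit
open RhW08.Round1 RhW08.StSwap RhW08.Round2 RhW08.QuadW RhW08.SealSwapQ RhW08.SealSwap RhW08.SuccB RhW08.SuccSplit
open RhW08.ClusterQ RhW08.ClusterQM RhW08.AntiEscapeSplit7

/-- The near polynomial of the one-body cluster `S = {v}`, `m ≡ 1`, is `z − v`. -/
theorem nearPoly_singleton_eval (v z : ℂ) : (nearPoly {v} (fun _ => 1)).eval z = z - v := by
  simp [nearPoly]

/-- The one-body pinned model is `M = 1 + K·(z − v)`. -/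
theorem tiltModel_singleton_eval (v K z : ℂ) : (tiltModel {v} (fun _ => 1) K).eval z = 1 + K * (z - v) := by
  simp [tiltModel, nearPoly]

/-- **ONE-BODY U FROM ISOLATION.**  See the module docstring. -/
theorem clusterNumbersU_of_isolated {f : ℂ → ℂ} (hf : Differentiable ℂ f) {x₀ R : ℝ} {j : ℕ} {v : ℂ}
    (hv : iteratedDeriv j f v = 0) (hv1 : iteratedDeriv (j + 1) f v ≠ 0) {ρ : ℝ} (hρ : 0 < ρ) (hρv : ρ ≤ v.im)
    (hcol : |v.re - x₀| + ρ ≤ R / 2)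
    (hiso : ∀ z : ℂ, iteratedDeriv j f z = 0 → z ≠ v → ρ < ‖z - v‖)
    (hK : 1 < ‖newtonK f j v‖ * ρ)
    (hvar : ∀ z : ℂ, ‖z - v‖ = ρ →
      ρ * ‖deriv (dslope (iteratedDeriv j f) v) z / dslope (iteratedDeriv j f) v z - newtonK f j v‖ <
        ‖1 + newtonK f j v * (z - v)‖) :
    ClusterNumbersU f x₀ R j := by
  set F : ℂ → ℂ := iteratedDeriv j f with hF_def
  set h : ℂ → ℂ := dslope F v with hh_def
  set K : ℂ := newtonK f j v with hK_def
  have hFd : Differentiable ℂ F := differentiable_iteratedDeriv_of_entire hf j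
  have hhd : Differentiable ℂ h :=
    differentiableOn_univ.1 ((Complex.differentiableOn_dslope (univ_mem : (univ : Set ℂ) ∈ 𝓝 v)).2 hFd.differentiableOn)
  have hfac : ∀ z, F z = (z - v) * h z := by
    intro z
    have e := sub_smul_dslope F v z
    rw [smul_eq_mul, hv, sub_zero] at e
    exact e.symm
  -- `h v = F′ v ≠ 0`
  have hhv : h v ≠ 0 := by
    rw [hh_def, dslope_same, hF_def, ← iteratedDeriv_succ]; exact hv1
  -- `h` is zero-free on the closed disc
  have hh0 : ∀ z : ℂ, ‖z - v‖ ≤ ρ → h z ≠ 0 := by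
    intro z hz hz0
    by_cases hzv : z = v
    · exact hhv (by rw [← hzv]; exact hz0)
    · have hFz : F z = 0 := by rw [hfac z, hz0, mul_zero]
      have := hiso z hFz hzv
      linarith
  -- `K ≠ 0`, `‖K⁻¹‖ < ρ`
  have hKpos : 0 < ‖K‖ := by
    by_contra h0
    push Not at h0
    have : ‖K‖ * ρ ≤ 0 := mul_nonpos_of_nonpos_of_nonneg h0 hρ.le
    linarith
  have hK0 : K ≠ 0 := norm_pos_iff.1 hKpos
  have hKinv : ‖K⁻¹‖ < ρ := by
    rw [norm_inv, inv_lt_comm₀ hKpos hρ]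
    calc ρ⁻¹ = ρ⁻¹ * 1 := (mul_one _).symm
      _ < ρ⁻¹ * (‖K‖ * ρ) := mul_lt_mul_of_pos_left hK (inv_pos.2 hρ)
      _ = ‖K‖ := by field_simp
  refine ⟨{v}, fun _ => 1, K, h, v, ρ, hρ, hρv, hcol, ?_, hhd, ?_, hh0, ?_, ?_⟩
  · intro u hu
    rw [Finset.mem_singleton] at hu
    rw [hu, sub_self, norm_zero]; exact hρ.le
  · intro z
    rw [nearPoly_singleton_eval]; exact hfac z
  · refine ⟨v - K⁻¹, ?_, ?_⟩
    · simpa using hKinv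
    · rw [tiltModel_singleton_eval]; field_simp; ring
  · intro z hz
    have hzv : h z ≠ 0 := hh0 z hz.le
    have hhz : 0 < ‖h z‖ := norm_pos_iff.2 hzv
    -- defect = `Q·(h′ − K h)`
    have hdef : iteratedDeriv (j + 1) f z - (tiltModel {v} (fun _ => 1) K).eval z * h z =
        (nearPoly {v} (fun _ => 1)).eval z * (deriv h z - K * h z) := by
      rw [iteratedDeriv_succ]
      exact deriv_sub_model_eq K hhd (fun w => by rw [nearPoly_singleton_eval]; exact hfac w) z
    rw [hdef, norm_mul, norm_mul, nearPoly_singleton_eval, hz, tiltModel_singleton_eval]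
    -- `‖h′ z − K h z‖ = ‖h z‖·‖h′/h − K‖`
    have hsplit : ‖deriv h z - K * h z‖ = ‖h z‖ * ‖deriv h z / h z - K‖ := by
      rw [← norm_mul]; congr 1; field_simp
    have hv' := hvar z hz
    rw [hsplit]
    calc ρ * (‖h z‖ * ‖deriv h z / h z - K‖) = (ρ * ‖deriv h z / h z - K‖) * ‖h z‖ := by ring
      _ < ‖1 + K * (z - v)‖ * ‖h z‖ := mul_lt_mul_of_pos_right hv' hhz

/-- The model's modulus on the circle dominates `‖K‖·ρ − 1` (triangle inequality); turns a UNIFORM variation bound into the pointwise one. -/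
theorem norm_model_ge (K v z : ℂ) {ρ : ℝ} (hz : ‖z - v‖ = ρ) : ‖K‖ * ρ - 1 ≤ ‖1 + K * (z - v)‖ := by
  have h1 : ‖K * (z - v)‖ ≤ ‖1 + K * (z - v)‖ + ‖(1 : ℂ)‖ := by
    calc ‖K * (z - v)‖ = ‖(1 + K * (z - v)) - 1‖ := by ring_nf
      _ ≤ ‖1 + K * (z - v)‖ + ‖(1 : ℂ)‖ := norm_sub_le _ _
  rw [norm_mul, hz, norm_one] at h1
  linarith

/-- (v0 form, information only) ONE-BODY U from the UNIFORM variation bound `ρ·‖h′/h − K‖ < ‖K‖ρ − 1` on the circle. -/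
theorem clusterNumbersU_of_isolated_of_uniform {f : ℂ → ℂ} (hf : Differentiable ℂ f) {x₀ R : ℝ} {j : ℕ} {v : ℂ}
    (hv : iteratedDeriv j f v = 0) (hv1 : iteratedDeriv (j + 1) f v ≠ 0) {ρ : ℝ} (hρ : 0 < ρ) (hρv : ρ ≤ v.im)
    (hcol : |v.re - x₀| + ρ ≤ R / 2)
    (hiso : ∀ z : ℂ, iteratedDeriv j f z = 0 → z ≠ v → ρ < ‖z - v‖)
    (hK : 1 < ‖newtonK f j v‖ * ρ)
    (hvar : ∀ z : ℂ, ‖z - v‖ = ρ →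
      ρ * ‖deriv (dslope (iteratedDeriv j f) v) z / dslope (iteratedDeriv j f) v z - newtonK f j v‖ <
        ‖newtonK f j v‖ * ρ - 1) :
    ClusterNumbersU f x₀ R j :=
  clusterNumbersU_of_isolated hf hv hv1 hρ hρv hcol hiso hK
    (fun z hz => lt_of_lt_of_le (hvar z hz) (norm_model_ge (newtonK f j v) v z hz))

/-- **ISOLATED-STATE SUCCESSOR** (frame corollary): the one-body U door then yields a level-`(j+1)` band state (`succ_of_clusterNumbersU`). -/
theorem succ_of_isolated {η : ℝ} {f : ℂ → ℂ} {x₀ s hmax R Hs : ℝ} {B j : ℕ} {v : ℂ}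
    (hE : EngineHyps5 2 η f x₀ s hmax R Hs B) (hst : StTrkDQ η f x₀ s hmax R Hs B j v)
    (hv1 : iteratedDeriv (j + 1) f v ≠ 0) {ρ : ℝ} (hρ : 0 < ρ) (hρv : ρ ≤ v.im)
    (hcol : |v.re - x₀| + ρ ≤ R / 2)
    (hiso : ∀ z : ℂ, iteratedDeriv j f z = 0 → z ≠ v → ρ < ‖z - v‖)
    (hK : 1 < ‖newtonK f j v‖ * ρ)
    (hvar : ∀ z : ℂ, ‖z - v‖ = ρ →
      ρ * ‖deriv (dslope (iteratedDeriv j f) v) z / dslope (iteratedDeriv j f) v z - newtonK f j v‖ <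
        ‖1 + newtonK f j v * (z - v)‖) :
    ∃ u : ℂ, StTrkDQ η f x₀ s hmax R Hs B (j + 1) u :=
  succ_of_clusterNumbersU hE hst (clusterNumbersU_of_isolated hE.1 hst.2.1 hv1 hρ hρv hcol hiso hK hvar)

/-! ## §2 Free centre and free model constant (v3, (CA462)(2), (CA470)(ii)) -/

/-- ONE-BODY MODEL DATA with a FREE CENTRE `c`: at a simple zero `v` of `F := f^{(j)}` (cofactor `h := dslope F v`, ANY model constant
`K : ℂ`), if `‖v − c‖ < ρ`, every other zero of `F` lies strictly outside `D̄(c, ρ)`, and the pointwise clause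
`‖z − v‖·‖(h′/h)(z) − K‖ < ‖1 + K(z − v)‖` holds on `‖z − c‖ = ρ`, then `h` is entire, `F = (· − v)·h`, `h` is zero-free on `D̄(c, ρ)`,
and `f^{(j+1)}` is dominated by the model `(1 + K(z − v))·h` on the circle. -/
theorem oneBody_model_data {f : ℂ → ℂ} (hf : Differentiable ℂ f) {j : ℕ} {v c K : ℂ}
    (hv : iteratedDeriv j f v = 0) (hv1 : iteratedDeriv (j + 1) f v ≠ 0) {ρ : ℝ} (hvc : ‖v - c‖ < ρ)
    (hiso : ∀ z : ℂ, iteratedDeriv j f z = 0 → z ≠ v → ρ < ‖z - c‖)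
    (hvar : ∀ z : ℂ, ‖z - c‖ = ρ →
      ‖z - v‖ * ‖deriv (dslope (iteratedDeriv j f) v) z / dslope (iteratedDeriv j f) v z - K‖ <
        ‖1 + K * (z - v)‖) :
    Differentiable ℂ (dslope (iteratedDeriv j f) v) ∧
    (∀ z : ℂ, iteratedDeriv j f z = (z - v) * dslope (iteratedDeriv j f) v z) ∧
    (∀ z : ℂ, ‖z - c‖ ≤ ρ → dslope (iteratedDeriv j f) v z ≠ 0) ∧
    (∀ z : ℂ, ‖z - c‖ = ρ →
      ‖iteratedDeriv (j + 1) f z - (1 + K * (z - v)) * dslope (iteratedDeriv j f) v z‖ <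
        ‖(1 + K * (z - v)) * dslope (iteratedDeriv j f) v z‖) := by
  set F : ℂ → ℂ := iteratedDeriv j f with hF_def
  set h : ℂ → ℂ := dslope F v with hh_def
  have hFd : Differentiable ℂ F := differentiable_iteratedDeriv_of_entire hf j
  have hhd : Differentiable ℂ h :=
    differentiableOn_univ.1 ((Complex.differentiableOn_dslope (univ_mem : (univ : Set ℂ) ∈ 𝓝 v)).2 hFd.differentiableOn)
  have hfac : ∀ z, F z = (z - v) * h z := by
    intro z
    have e := sub_smul_dslope F v z
    rw [smul_eq_mul, hv, sub_zero] at e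
    exact e.symm
  have hhv : h v ≠ 0 := by
    rw [hh_def, dslope_same, hF_def, ← iteratedDeriv_succ]; exact hv1
  have hh0 : ∀ z : ℂ, ‖z - c‖ ≤ ρ → h z ≠ 0 := by
    intro z hz hz0
    by_cases hzv : z = v
    · exact hhv (by rw [← hzv]; exact hz0)
    · have hFz : F z = 0 := by rw [hfac z, hz0, mul_zero]
      have := hiso z hFz hzv
      linarith
  refine ⟨hhd, hfac, hh0, ?_⟩
  intro z hz
  have hzv : h z ≠ 0 := hh0 z hz.le
  have hhz : 0 < ‖h z‖ := norm_pos_iff.2 hzv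
  have hdef : iteratedDeriv (j + 1) f z - (tiltModel {v} (fun _ => 1) K).eval z * h z =
      (nearPoly {v} (fun _ => 1)).eval z * (deriv h z - K * h z) := by
    rw [iteratedDeriv_succ]
    exact deriv_sub_model_eq K hhd (fun w => by rw [nearPoly_singleton_eval]; exact hfac w) z
  rw [tiltModel_singleton_eval] at hdef
  rw [hdef, norm_mul, norm_mul, nearPoly_singleton_eval]
  have hsplit : ‖deriv h z - K * h z‖ = ‖h z‖ * ‖deriv h z / h z - K‖ := by
    rw [← norm_mul]; congr 1; field_simp
  rw [hsplit]
  calc ‖z - v‖ * (‖h z‖ * ‖deriv h z / h z - K‖) = (‖z - v‖ * ‖deriv h z / h z - K‖) * ‖h z‖ := by ring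
    _ < ‖1 + K * (z - v)‖ * ‖h z‖ := mul_lt_mul_of_pos_right (hvar z hz) hhz

/-- ★ ONE-BODY U WITH A FREE CENTRE (door-U currency, (CA462)(2)): disc `D(c, ρ)` with `‖v − c‖ < ρ ≤ Im c` inside the column, every other
zero of `f^{(j)}` strictly outside `D̄(c, ρ)`, a model zero inside (`∃ z₀ ∈ D(c, ρ), 1 + K(z₀ − v) = 0`, i.e. the Newton child `v − K⁻¹`), and
the pointwise clause on `‖z − c‖ = ρ` ⇒ `ClusterNumbersU f x₀ R j` with `S = {v}`, centre `c`. -/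
theorem clusterNumbersU_of_isolated_center {f : ℂ → ℂ} (hf : Differentiable ℂ f) {x₀ R : ℝ} {j : ℕ} {v c K : ℂ}
    (hv : iteratedDeriv j f v = 0) (hv1 : iteratedDeriv (j + 1) f v ≠ 0) {ρ : ℝ} (hρ : 0 < ρ) (hvc : ‖v - c‖ < ρ)
    (hρc : ρ ≤ c.im) (hcol : |c.re - x₀| + ρ ≤ R / 2)
    (hiso : ∀ z : ℂ, iteratedDeriv j f z = 0 → z ≠ v → ρ < ‖z - c‖)
    (hMz : ∃ z₀ : ℂ, ‖z₀ - c‖ < ρ ∧ 1 + K * (z₀ - v) = 0)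
    (hvar : ∀ z : ℂ, ‖z - c‖ = ρ →
      ‖z - v‖ * ‖deriv (dslope (iteratedDeriv j f) v) z / dslope (iteratedDeriv j f) v z - K‖ <
        ‖1 + K * (z - v)‖) :
    ClusterNumbersU f x₀ R j := by
  obtain ⟨hhd, hfac, hh0, hdom⟩ := oneBody_model_data hf hv hv1 hvc hiso hvar
  refine ⟨{v}, fun _ => 1, K, dslope (iteratedDeriv j f) v, c, ρ, hρ, hρc, hcol, ?_, hhd, ?_, hh0, ?_, ?_⟩
  · intro u hu
    rw [Finset.mem_singleton] at hu
    rw [hu]; exact hvc.le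
  · intro z
    rw [nearPoly_singleton_eval]; exact hfac z
  · obtain ⟨z₀, hz₀, hM⟩ := hMz
    exact ⟨z₀, hz₀, by rw [tiltModel_singleton_eval]; exact hM⟩
  · intro z hz
    rw [tiltModel_singleton_eval]; exact hdom z hz

/-- Frame corollary of `clusterNumbersU_of_isolated_center` (`succ_of_clusterNumbersU`). -/
theorem succ_of_isolated_center {η : ℝ} {f : ℂ → ℂ} {x₀ s hmax R Hs : ℝ} {B j : ℕ} {v c K : ℂ}
    (hE : EngineHyps5 2 η f x₀ s hmax R Hs B) (hst : StTrkDQ η f x₀ s hmax R Hs B j v)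
    (hv1 : iteratedDeriv (j + 1) f v ≠ 0) {ρ : ℝ} (hρ : 0 < ρ) (hvc : ‖v - c‖ < ρ) (hρc : ρ ≤ c.im)
    (hcol : |c.re - x₀| + ρ ≤ R / 2)
    (hiso : ∀ z : ℂ, iteratedDeriv j f z = 0 → z ≠ v → ρ < ‖z - c‖)
    (hMz : ∃ z₀ : ℂ, ‖z₀ - c‖ < ρ ∧ 1 + K * (z₀ - v) = 0)
    (hvar : ∀ z : ℂ, ‖z - c‖ = ρ →
      ‖z - v‖ * ‖deriv (dslope (iteratedDeriv j f) v) z / dslope (iteratedDeriv j f) v z - K‖ <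
        ‖1 + K * (z - v)‖) :
    ∃ u : ℂ, StTrkDQ η f x₀ s hmax R Hs B (j + 1) u :=
  succ_of_clusterNumbersU hE hst (clusterNumbersU_of_isolated_center hE.1 hst.2.1 hv1 hρ hvc hρc hcol hiso hMz hvar)

/-- ★★ ISOLATED-STATE SUCCESSOR WITH A FREE CENTRE AND A POINTWISE WINDOW (successor currency): as `succ_of_isolated_center` but with the
column clause replaced by the level-`(j+1)` window taken POINTWISE on the disc (`RhW08.ClusterQM.succ_of_upper_model_zero_pt`), so the
disc may overhang the column edge `|Re z − x₀| = R/2` where the lateral budget allows it. -/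
theorem succ_of_isolated_pt {η : ℝ} {f : ℂ → ℂ} {x₀ s hmax R Hs : ℝ} {B j : ℕ} {v c K : ℂ}
    (hE : EngineHyps5 2 η f x₀ s hmax R Hs B) (hst : StTrkDQ η f x₀ s hmax R Hs B j v)
    (hv1 : iteratedDeriv (j + 1) f v ≠ 0) {ρ : ℝ} (hρ : 0 < ρ) (hvc : ‖v - c‖ < ρ) (hρc : ρ ≤ c.im)
    (hiso : ∀ z : ℂ, iteratedDeriv j f z = 0 → z ≠ v → ρ < ‖z - c‖)
    (hMz : ∃ z₀ : ℂ, ‖z₀ - c‖ < ρ ∧ 1 + K * (z₀ - v) = 0)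
    (hvar : ∀ z : ℂ, ‖z - c‖ = ρ →
      ‖z - v‖ * ‖deriv (dslope (iteratedDeriv j f) v) z / dslope (iteratedDeriv j f) v z - K‖ <
        ‖1 + K * (z - v)‖)
    (hdisc : ∀ z : ℂ, ‖z - c‖ < ρ → |z.im| ≤ Hs →
      (max (|z.re - x₀| - R / 2) 0) ^ 2 + ((j : ℝ) + 1) * z.im ^ 2 ≤ ((j : ℝ) + 1) * Hs ^ 2) :
    ∃ u : ℂ, StTrkDQ η f x₀ s hmax R Hs B (j + 1) u := by
  obtain ⟨hhd, -, hh0, hdom⟩ := oneBody_model_data hE.1 hst.2.1 hv1 hvc hiso hvar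
  have hcim : 0 < c.im := lt_of_lt_of_le hρ hρc
  have hoff : ρ ≤ |c.im| := by rwa [abs_of_pos hcim]
  have hM : Differentiable ℂ (fun z : ℂ => 1 + K * (z - v)) := by fun_prop
  have hMne : (fun z : ℂ => 1 + K * (z - v)) ≠ 0 := by
    intro h0
    have h1 := congrFun h0 v
    simp at h1
  exact succ_of_upper_model_zero_pt hE hst hρ hoff hhd hM hMne hh0 hdom hMz hdisc

end

end RhW08.Lens1OneBody
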